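import Summits.QuantumFields.YangMills.Theorems.BalabanUVNodesN15KingModelHeatKernelGreenPowerLawFour
import Summits.QuantumFields.YangMills.Theorems.BalabanUVNodesN15KingModelAnalyticDeterminantVolumeLawDecouplingKernel
import HarnessLib

/-!
# BalabanUVNodes ∕ N15 — THE KING-MODEL RUNG (PART Ϣ-i): THE η-UNIFORM CLUSTER PROPERTY OF KING's COVARIANCE AND THE η-UNIFORM, DECAYING DECOUPLING OF THE FINE GAUSSIAN NORMALISATION —
# at King's scaling `c = L²` on `(ℤ∕LM₀)⁴`: `L²|G(x,y)| ≤ (34016 + 10∕m²)∕(1 + |v((x−y)_ν)|²)` for every `ν`, every `L ≥ 1`, every `M₀ ≥ 1`; the same for the COVARIANT fine covariance `(−cΔ_U+m²)⁻¹` at every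
# unitary `U` (diamagnetic domination); and Ϯ-n BY NAME: `|ln det M(U₁+U₂−U₀) − ln det M(U₁) − ln det M(U₂) + ln det M(U₀)| ≤ 16|n|⁴·((34016 + 10∕m²)∕(1+D²))²·#Z₁#Z₂` when the supports are `≥ D` apart
# (Track A, DAG node N15 = NE2; FAN-OUT v1.1 §N15 s3 «KING-MODEL RUNG … + what the curved case adds»; count-neutral)

HONEST FRAMING.  Count-neutral (cell `pub-ymgap`, seat `pub-ymgap-dag-n15-e` g55; `--supports stmt-QuantumFields-27247 --as helper` = K3ᴬ).  PART Ϣ-h proved on the cubic four-torus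
`(ℤ∕K₀)⁴`: `c|(lapF (cM K₀) c m²)⁻¹(x,y)| ≤ 34016∕(1+|v((x−y)_ν)|²) + 8c∕(m²K₀⁴)` (every `ν`).  THIS FILE: (§1) KING's SCALING `c = L² = η⁻²` ((2.13) p.653), fine torus `(ℤ∕LM₀)⁴`
(`fine L (cM M₀) = cM (LM₀)` definitionally, as in Ϯ-e): the zero mode is `8∕(m²L²M₀⁴) ≤ 10∕(m²(1+|v|²))` (`|v| ≤ LM₀∕2`), so ★★★★ **`king_green_powerLaw_eta_uniform`**:
`L²|G(x,y)| ≤ (34016 + 10∕m²)∕(1 + |v((x−y)_ν)|²)` — the CLUSTER PROPERTY of King's `A = 0` covariance in lattice units, UNIFORM IN `η = 1∕L` AND IN THE VOLUME `M₀` (inside the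
correlation length the physical `1∕(4π²|x−y|²_phys)·η²` law in lattice dress; Ε-d's `(2∕m²)e^{−κ_F·dist}` is `O(L²∕m²)`, Ϯ-e's `5∕4 + …` does not decay); (§2) WHAT THE CURVED CASE ADDS —
NOTHING for the fine covariance: Kato's diamagnetic domination at every unitary background (Ϯ-n §1 ∕ Ͱ-b ∕ Ϛ-d BY NAME: `‖((−cΔ_U+m²)⁻¹)_{(x,i),(y,j)}‖ ≤ G(x,y)`) transfers the power law
verbatim: ★★★★ **`norm_covLapF_inv_entry_le_powerLaw`** (every torus side `K₀`, every unitary `U`, any `RCLike` fibre) and ★★★ its η-uniform King-scaling face; the block term `aQ(U)^*Q(U)`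
of the full propagator and the block-field covariance `Δ_eff(U)⁻¹` are NOT covered (their decay is PART Ϧ∕Ϫ's Combes–Thomas, `O(η)`-Lipschitz — an η-uniform POWER law for them is the
successor door); (§3) THE DECOUPLING: Ϯ-n's kernel form `abs_log_det_covLapF_decoupling_of_kernel_le` with `β = (34016∕(1+D²) + 8c∕(m²K₀⁴))∕c` ⟹ ★★★★ **`abs_log_det_covLapF_decoupling_powerLaw`**
(`≤ 16|n|⁴(34016∕(1+D²) + 8c∕(m²K₀⁴))²#Z₁#Z₂` whenever every endpoint pair of `Z₁ × Z₂` is `≥ D` apart in some coordinate — `c²` CANCELS: η-uniform AND decaying), and at King's scaling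
★★★★ **`abs_log_det_covLapF_decoupling_powerLaw_eta_uniform`** (`≤ 16|n|⁴((34016 + 10∕m²)∕(1+D²))²#Z₁#Z₂`, every `L`, every volume; in physical units `D = L·D_phys`, so `O(η⁴∕D_phys⁴)`).
Constants crude and absolute.  FINE normalisation `ln det(−cΔ_U+m²)` only (`ℝ` fibre, as Ϯ-l∕Ϯ-n); NOT `Δ_eff`∕`A₀` (door t2⁶⁰); NOT Bałaban's (3.42); NOT a node discharge (N15 of record
untouched); nothing continuum ∕ ℝ⁴ ∕ OS ∕ mass gap ∕ Clay.
PRIOR TREE ART (by name): PART Ϣ-h (`mul_abs_lapF_inv_le_powerLaw`, `mul_abs_lapF_inv_le_of_dist_le`); Ϯ-n `…VolumeLawDecouplingKernel` (`norm_covLapF_inv_entry_le_lapF_inv_of_norm_le`,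
`abs_log_det_covLapF_decoupling_of_kernel_le`, `abs_log_det_covLapF_decoupling_eta_uniform` = the non-decaying face this file sharpens); Ͱ-a `covLapF`; `B5Prop11Plancherel` (`fine`, `unitVec`);
`Beta.WoodburyFibre.cM`; Ͱ-l `l2_opNorm_of_mem_unitaryGroup_le`.
Dedup (rg at filing): basename 0 files; needles `king_green_powerLaw_eta_uniform|norm_covLapF_inv_entry_le_powerLaw|abs_log_det_covLapF_decoupling_powerLaw|king_powerLaw_package|zeroMode_le_of_absV_le` 0 tree files.
Locators: [King1986] (2.13) p.653 (`c = L²`), (3.94)–(3.96) p.669 (the determinants), (4.4) p.670, (4.35) p.674; [Balaban1985BackgroundPropagators] (3.23) p.394, (3.42) p.397, Thm 3.4 p.400;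
[LawlerLimic2010] Thm 4.3.1.  0 `sorry`, 0 `def`.
-/

noncomputable section

open Real Set Finset Matrix
open scoped BigOperators Matrix.Norms.L2Operator

namespace Summit.QuantumFields.YangMills.BalabanUVNodes.N15KingModelRung.HeatKernel

open Literature.MathematicalPhysics.QuantumFieldTheory.Balaban1983to89.B5Prop11Plancherel (Tor fine unitVec)
open Literature.MathematicalPhysics.QuantumFieldTheory.Balaban1983to89.Beta.WoodburyFibre (cM)
open Literature.MathematicalPhysics.QuantumFieldTheory.King1986.Torus (lapF)
open Summit.QuantumFields.YangMills.BalabanUVNodes.N15KingModelRung.Covariant (covLapF l2_opNorm_of_mem_unitaryGroup_le)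
open Summit.QuantumFields.YangMills.BalabanUVNodes.N15KingModelRung.Analytic (norm_covLapF_inv_entry_le_lapF_inv_of_norm_le abs_log_det_covLapF_decoupling_of_kernel_le)

/-! ## §1 King's scaling: the η-uniform cluster property -/

/-- The zero mode against the torus distance: for `|v| ≤ K₀∕2`, `1∕K₀² ≤ (5∕4)∕(1+|v|²)`. [folklore] -/
theorem inv_sq_le_of_le_half {K₀ v : ℝ} (hK : 1 ≤ K₀) (hv0 : 0 ≤ v) (hv : v ≤ K₀ / 2) : 1 / K₀ ^ 2 ≤ (5 / 4) / (1 + v ^ 2) := by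
  rw [div_le_div_iff₀ (by positivity) (by positivity)]
  nlinarith [mul_le_mul hv hv hv0 (by positivity : (0:ℝ) ≤ K₀ / 2)]

section KingScaling

variable (L M₀ : ℕ) [NeZero L] [NeZero M₀]

/-- ★★★★ **KING's COVARIANCE DECAYS LIKE THE INVERSE SQUARE OF THE TORUS DISTANCE, UNIFORMLY IN η AND IN THE VOLUME** (`d+1 = 4`, King's scaling `c = L²`, fine torus `(ℤ∕LM₀)⁴`): for every
coordinate `ν`, `L²·|(lapF (fine L (cM M₀)) L² m²)⁻¹(x,y)| ≤ 34016∕(1 + |v((x−y)_ν)|²) + 8∕(m²L²M₀⁴)` for every `L ≥ 1`, `M₀ ≥ 1`, `m² > 0`.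
[cite: King1986, (2.13) p.653, (4.4) p.670, (4.35) p.674; Balaban1984PropagatorsI, (1.29) p.23] -/
theorem king_green_powerLaw_eta_uniform_zeroMode {m2 : ℝ} (hm : 0 < m2) (x y : Tor (fine L (cM M₀))) (ν : Fin 4) :
    (L : ℝ) ^ 2 * |(lapF (fine L (cM M₀)) ((L : ℝ) ^ 2) m2)⁻¹ x y|
      ≤ 34016 / (1 + ((((x - y) ν).valMinAbs.natAbs : ℕ) : ℝ) ^ 2) + 8 / (m2 * (L : ℝ) ^ 2 * (M₀ : ℝ) ^ 4) := by
  have hL : (0 : ℝ) < L := by exact_mod_cast Nat.pos_of_ne_zero (NeZero.ne L)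
  have hc : (0 : ℝ) < (L : ℝ) ^ 2 := by positivity
  haveI : NeZero (L * M₀) := ⟨Nat.mul_ne_zero (NeZero.ne L) (NeZero.ne M₀)⟩
  have h := mul_abs_lapF_inv_le_powerLaw (K₀ := L * M₀) hc hm x y ν
  have e : 8 * (L : ℝ) ^ 2 / (m2 * ((L * M₀ : ℕ) : ℝ) ^ 4) = 8 / (m2 * (L : ℝ) ^ 2 * (M₀ : ℝ) ^ 4) := by
    push_cast; field_simp
  rw [e] at h
  exact h

/-- ★★★★ **THE η-UNIFORM CLUSTER PROPERTY**: `L²·|G(x,y)| ≤ (34016 + 10∕m²)∕(1 + |v((x−y)_ν)|²)` for EVERY coordinate `ν`, every `L ≥ 1`, every volume `M₀ ≥ 1` (the zero mode `8∕(m²L²M₀⁴)` is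
`≤ 10∕(m²(1+|v|²))` because `|v| ≤ LM₀∕2`). [cite: King1986, (2.13) p.653, (4.4) p.670, (4.35) p.674] -/
theorem king_green_powerLaw_eta_uniform {m2 : ℝ} (hm : 0 < m2) (x y : Tor (fine L (cM M₀))) (ν : Fin 4) :
    (L : ℝ) ^ 2 * |(lapF (fine L (cM M₀)) ((L : ℝ) ^ 2) m2)⁻¹ x y| ≤ (34016 + 10 / m2) / (1 + ((((x - y) ν).valMinAbs.natAbs : ℕ) : ℝ) ^ 2) := by
  have hL1 : (1 : ℝ) ≤ L := by exact_mod_cast Nat.one_le_iff_ne_zero.mpr (NeZero.ne L)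
  have hM1 : (1 : ℝ) ≤ M₀ := by exact_mod_cast Nat.one_le_iff_ne_zero.mpr (NeZero.ne M₀)
  have h := king_green_powerLaw_eta_uniform_zeroMode L M₀ hm x y ν
  set v : ℝ := ((((x - y) ν).valMinAbs.natAbs : ℕ) : ℝ) with hv
  have hv0 : 0 ≤ v := by positivity
  have hvK : v ≤ ((L : ℝ) * M₀) / 2 := by
    have h1 : ((x - y) ν).valMinAbs.natAbs ≤ (L * M₀) / 2 := ZMod.natAbs_valMinAbs_le ((x - y) ν)
    have h2 : (((x - y) ν).valMinAbs.natAbs : ℝ) ≤ (((L * M₀) / 2 : ℕ) : ℝ) := by exact_mod_cast h1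
    refine h2.trans ?_
    have := Nat.cast_div_le (m := L * M₀) (n := 2) (α := ℝ)
    push_cast at this
    exact this
  have hK1 : (1 : ℝ) ≤ (L : ℝ) * M₀ := one_le_mul_of_one_le_of_one_le hL1 hM1
  have hzm : 8 / (m2 * (L : ℝ) ^ 2 * (M₀ : ℝ) ^ 4) ≤ (10 / m2) / (1 + v ^ 2) := by
    have h3 := inv_sq_le_of_le_half hK1 hv0 hvK
    have h4 : 8 / (m2 * (L : ℝ) ^ 2 * (M₀ : ℝ) ^ 4) ≤ 8 / m2 * (1 / ((L : ℝ) * M₀) ^ 2) := by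
      rw [div_mul_eq_mul_div, mul_one_div, div_div]
      apply div_le_div_of_nonneg_left (by norm_num) (by positivity)
      have : (M₀ : ℝ) ^ 2 ≤ (M₀ : ℝ) ^ 4 := by nlinarith [one_le_pow₀ hM1 (n := 2)]
      nlinarith [mul_le_mul_of_nonneg_left this (by positivity : (0:ℝ) ≤ m2 * (L : ℝ) ^ 2)]
    calc 8 / (m2 * (L : ℝ) ^ 2 * (M₀ : ℝ) ^ 4) ≤ 8 / m2 * (1 / ((L : ℝ) * M₀) ^ 2) := h4
      _ ≤ 8 / m2 * ((5 / 4) / (1 + v ^ 2)) := mul_le_mul_of_nonneg_left h3 (by positivity)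
      _ = (10 / m2) / (1 + v ^ 2) := by ring
  calc (L : ℝ) ^ 2 * |(lapF (fine L (cM M₀)) ((L : ℝ) ^ 2) m2)⁻¹ x y| ≤ 34016 / (1 + v ^ 2) + 8 / (m2 * (L : ℝ) ^ 2 * (M₀ : ℝ) ^ 4) := h
    _ ≤ 34016 / (1 + v ^ 2) + (10 / m2) / (1 + v ^ 2) := add_le_add le_rfl hzm
    _ = (34016 + 10 / m2) / (1 + v ^ 2) := by ring

end KingScaling

/-! ## §2 What the curved case adds: nothing, for the fine covariance (diamagnetic domination at every unitary background) -/

section Curved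

variable {K₀ : ℕ} [NeZero K₀] {𝕜 : Type*} [RCLike 𝕜] {n : Type*} [Fintype n] [DecidableEq n] {c m2 : ℝ}

/-- ★★★★ **THE POWER LAW FOR THE COVARIANT FINE COVARIANCE AT EVERY UNITARY BACKGROUND**: for every unitary link field `U` on the cubic four-torus and every fibre indices,
`c·‖((−cΔ_U+m²)⁻¹)_{(x,i),(y,j)}‖ ≤ 34016∕(1 + |v((x−y)_ν)|²) + 8c∕(m²K₀⁴)` — Kato's domination (Ϯ-n §1 BY NAME) followed by PART Ϣ-h.
[cite: Balaban1985BackgroundPropagators, Thm 3.4 p.400, (3.42) p.397; King1986, (2.13) p.653, (4.4) p.670] -/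
theorem norm_covLapF_inv_entry_le_powerLaw (hc : 0 < c) (hm : 0 < m2) {U : Tor (cM K₀) × Fin 4 → Matrix n n 𝕜} (hU : ∀ b, U b ∈ Matrix.unitaryGroup n 𝕜)
    (x y : Tor (cM K₀)) (i j : n) (ν : Fin 4) :
    c * ‖(covLapF (cM K₀) c m2 U)⁻¹ (x, i) (y, j)‖ ≤ 34016 / (1 + ((((x - y) ν).valMinAbs.natAbs : ℕ) : ℝ) ^ 2) + 8 * c / (m2 * (K₀ : ℝ) ^ 4) := by
  have hW : ∀ b, ‖U b‖ ≤ 1 + 0 := fun b => by rw [add_zero]; exact l2_opNorm_of_mem_unitaryGroup_le (hU b)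
  have hk := norm_covLapF_inv_entry_le_lapF_inv_of_norm_le (cM K₀) hc.le hm hW x y i j
  have hp := mul_abs_lapF_inv_le_powerLaw (K₀ := K₀) hc hm x y ν
  calc c * ‖(covLapF (cM K₀) c m2 U)⁻¹ (x, i) (y, j)‖ ≤ c * (lapF (cM K₀) c m2)⁻¹ x y := mul_le_mul_of_nonneg_left hk hc.le
    _ ≤ c * |(lapF (cM K₀) c m2)⁻¹ x y| := mul_le_mul_of_nonneg_left (le_abs_self _) hc.le
    _ ≤ _ := hp

end Curved

section CurvedKing

variable (L M₀ : ℕ) [NeZero L] [NeZero M₀] {𝕜 : Type*} [RCLike 𝕜] {n : Type*} [Fintype n] [DecidableEq n] {m2 : ℝ}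

/-- ★★★ … at King's scaling: `L²·‖((−L²Δ_U+m²)⁻¹)_{(x,i),(y,j)}‖ ≤ (34016 + 10∕m²)∕(1 + |v((x−y)_ν)|²)` for every unitary `U` on `(ℤ∕LM₀)⁴`, every `L`, every volume — the η-uniform cluster property
survives the curved background on the fine covariance layer. [cite: Balaban1985BackgroundPropagators, Thm 3.4 p.400; King1986, (2.13) p.653, (4.4) p.670] -/
theorem norm_covLapF_inv_entry_le_powerLaw_eta_uniform (hm : 0 < m2) {U : Tor (fine L (cM M₀)) × Fin 4 → Matrix n n 𝕜} (hU : ∀ b, U b ∈ Matrix.unitaryGroup n 𝕜)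
    (x y : Tor (fine L (cM M₀))) (i j : n) (ν : Fin 4) :
    (L : ℝ) ^ 2 * ‖(covLapF (fine L (cM M₀)) ((L : ℝ) ^ 2) m2 U)⁻¹ (x, i) (y, j)‖ ≤ (34016 + 10 / m2) / (1 + ((((x - y) ν).valMinAbs.natAbs : ℕ) : ℝ) ^ 2) := by
  have hL : (0 : ℝ) < L := by exact_mod_cast Nat.pos_of_ne_zero (NeZero.ne L)
  have hc : (0 : ℝ) < (L : ℝ) ^ 2 := by positivity
  have hW : ∀ b, ‖U b‖ ≤ 1 + 0 := fun b => by rw [add_zero]; exact l2_opNorm_of_mem_unitaryGroup_le (hU b)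
  have hk := norm_covLapF_inv_entry_le_lapF_inv_of_norm_le (fine L (cM M₀)) hc.le hm hW x y i j
  have hp := king_green_powerLaw_eta_uniform L M₀ hm x y ν
  calc (L : ℝ) ^ 2 * ‖(covLapF (fine L (cM M₀)) ((L : ℝ) ^ 2) m2 U)⁻¹ (x, i) (y, j)‖ ≤ (L : ℝ) ^ 2 * (lapF (fine L (cM M₀)) ((L : ℝ) ^ 2) m2)⁻¹ x y :=
        mul_le_mul_of_nonneg_left hk hc.le
    _ ≤ (L : ℝ) ^ 2 * |(lapF (fine L (cM M₀)) ((L : ℝ) ^ 2) m2)⁻¹ x y| := mul_le_mul_of_nonneg_left (le_abs_self _) hc.le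
    _ ≤ _ := hp

end CurvedKing

/-! ## §3 The η-uniform AND decaying decoupling of the fine Gaussian normalisation -/

section Decoupling

variable {K₀ : ℕ} [NeZero K₀] {n : Type*} [Fintype n] [DecidableEq n] [Nonempty n]
variable {c m2 : ℝ} (hc : 0 < c) (hm : 0 < m2)
variable {U₀ U₁ U₂ : Tor (cM K₀) × Fin 4 → Matrix n n ℝ} (hU₀ : ∀ b, U₀ b ∈ Matrix.unitaryGroup n ℝ) (hU₁ : ∀ b, U₁ b ∈ Matrix.unitaryGroup n ℝ)
  (hU₂ : ∀ b, U₂ b ∈ Matrix.unitaryGroup n ℝ)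
variable {Z₁ Z₂ : Finset (Tor (cM K₀) × Fin 4)} (h₁ : ∀ b, b ∉ Z₁ → U₁ b = U₀ b) (h₂ : ∀ b, b ∉ Z₂ → U₂ b = U₀ b) (hZ : Disjoint Z₁ Z₂)
variable {D : ℝ} (hD0 : 0 ≤ D)
  (hsep : ∀ x y : Tor (cM K₀), (∃ b ∈ Z₁, x = b.1 ∨ x = b.1 + unitVec (cM K₀) b.2) → (∃ b ∈ Z₂, y = b.1 ∨ y = b.1 + unitVec (cM K₀) b.2) →
    ∃ ν : Fin 4, D ≤ ((((x - y) ν).valMinAbs.natAbs : ℕ) : ℝ))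
include hc hm hU₀ hU₁ hU₂ h₁ h₂ hZ hD0 hsep

/-- ★★★★ **DECOUPLING WITH THE POWER LAW** (cubic four-torus, every `c > 0`, `m² > 0`): if every endpoint of `Z₁` is at least `D` from every endpoint of `Z₂` in some coordinate, then
`|ln det M(U₁+U₂−U₀) − ln det M(U₁) − ln det M(U₂) + ln det M(U₀)| ≤ 16|n|⁴·(34016∕(1+D²) + 8c∕(m²K₀⁴))²·#Z₁·#Z₂` — Ϯ-n's kernel form with `β = (34016∕(1+D²) + 8c∕(m²K₀⁴))∕c`; the `c²` of Ϯ-n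
CANCELS against `β²`: the bound is uniform in `c∕m²` (except through the zero mode) AND decays in `D`. [cite: King1986, (2.13) p.653, (3.94)–(3.96) p.669, (4.4) p.670;
Balaban1985BackgroundPropagators, (3.23) p.394, (3.42) p.397, Thm 3.4 p.400] -/
theorem abs_log_det_covLapF_decoupling_powerLaw :
    |Real.log (covLapF (cM K₀) c m2 (U₁ + U₂ - U₀)).det - Real.log (covLapF (cM K₀) c m2 U₁).det - Real.log (covLapF (cM K₀) c m2 U₂).det + Real.log (covLapF (cM K₀) c m2 U₀).det|
      ≤ 16 * (Fintype.card n : ℝ) ^ 4 * (34016 / (1 + D ^ 2) + 8 * c / (m2 * (K₀ : ℝ) ^ 4)) ^ 2 * Z₁.card * Z₂.card := by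
  set B : ℝ := 34016 / (1 + D ^ 2) + 8 * c / (m2 * (K₀ : ℝ) ^ 4) with hB
  have hker : ∀ x y : Tor (cM K₀), (∃ b ∈ Z₁, x = b.1 ∨ x = b.1 + unitVec (cM K₀) b.2) → (∃ b ∈ Z₂, y = b.1 ∨ y = b.1 + unitVec (cM K₀) b.2) →
      (lapF (cM K₀) c m2)⁻¹ x y ≤ B / c := by
    intro x y hx hy
    have h := mul_abs_lapF_inv_le_of_dist_le (K₀ := K₀) hc hm x y hD0 (hsep x y hx hy)
    rw [le_div_iff₀ hc, mul_comm]
    exact (mul_le_mul_of_nonneg_left (le_abs_self _) hc.le).trans h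
  have h := abs_log_det_covLapF_decoupling_of_kernel_le (cM K₀) hc.le hm hU₀ hU₁ hU₂ h₁ h₂ hZ hker
  refine h.trans (le_of_eq ?_)
  field_simp

end Decoupling

section DecouplingKing

variable (L M₀ : ℕ) [NeZero L] [NeZero M₀] {n : Type*} [Fintype n] [DecidableEq n] [Nonempty n]
variable {m2 : ℝ} (hm : 0 < m2)
variable {U₀ U₁ U₂ : Tor (fine L (cM M₀)) × Fin 4 → Matrix n n ℝ} (hU₀ : ∀ b, U₀ b ∈ Matrix.unitaryGroup n ℝ) (hU₁ : ∀ b, U₁ b ∈ Matrix.unitaryGroup n ℝ)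
  (hU₂ : ∀ b, U₂ b ∈ Matrix.unitaryGroup n ℝ)
variable {Z₁ Z₂ : Finset (Tor (fine L (cM M₀)) × Fin 4)} (h₁ : ∀ b, b ∉ Z₁ → U₁ b = U₀ b) (h₂ : ∀ b, b ∉ Z₂ → U₂ b = U₀ b) (hZ : Disjoint Z₁ Z₂)
variable {D : ℝ} (hD0 : 0 ≤ D)
  (hsep : ∀ x y : Tor (fine L (cM M₀)), (∃ b ∈ Z₁, x = b.1 ∨ x = b.1 + unitVec (fine L (cM M₀)) b.2) → (∃ b ∈ Z₂, y = b.1 ∨ y = b.1 + unitVec (fine L (cM M₀)) b.2) →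
    ∃ ν : Fin 4, D ≤ ((((x - y) ν).valMinAbs.natAbs : ℕ) : ℝ))
include hm hU₀ hU₁ hU₂ h₁ h₂ hZ hD0 hsep

/-- ★★★★ **THE η-UNIFORM, DECAYING DECOUPLING AT KING's SCALING** (`c = L²`, fine torus `(ℤ∕LM₀)⁴`): under the same separation hypothesis,
`|ln det M(U₁+U₂−U₀) − ln det M(U₁) − ln det M(U₂) + ln det M(U₀)| ≤ 16|n|⁴·(34016∕(1+D²) + 8∕(m²L²M₀⁴))²·#Z₁·#Z₂` for EVERY `L ≥ 1` and EVERY volume — Ϯ-n's η-uniform face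
`16|n|⁴(5∕4+1∕m²)²#Z₁#Z₂` had no decay and Ϯ-l's decaying face was `O(L⁴∕m⁴)`; this one is both (in physical units `D = L·D_phys`: the interaction of two distant changes is `O(η⁴∕D_phys⁴)` per
bond pair, up to the zero mode `O(η²∕M₀⁴)`). [cite: King1986, (2.13) p.653, (3.94)–(3.96) p.669, (4.4) p.670; Balaban1985BackgroundPropagators, (3.42) p.397, Thm 3.4 p.400] -/
theorem abs_log_det_covLapF_decoupling_powerLaw_eta_uniform :
    |Real.log (covLapF (fine L (cM M₀)) ((L : ℝ) ^ 2) m2 (U₁ + U₂ - U₀)).det - Real.log (covLapF (fine L (cM M₀)) ((L : ℝ) ^ 2) m2 U₁).det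
        - Real.log (covLapF (fine L (cM M₀)) ((L : ℝ) ^ 2) m2 U₂).det + Real.log (covLapF (fine L (cM M₀)) ((L : ℝ) ^ 2) m2 U₀).det|
      ≤ 16 * (Fintype.card n : ℝ) ^ 4 * (34016 / (1 + D ^ 2) + 8 / (m2 * (L : ℝ) ^ 2 * (M₀ : ℝ) ^ 4)) ^ 2 * Z₁.card * Z₂.card := by
  have hL : (0 : ℝ) < L := by exact_mod_cast Nat.pos_of_ne_zero (NeZero.ne L)
  have hc : (0 : ℝ) < (L : ℝ) ^ 2 := by positivity
  haveI : NeZero (L * M₀) := ⟨Nat.mul_ne_zero (NeZero.ne L) (NeZero.ne M₀)⟩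
  have h := abs_log_det_covLapF_decoupling_powerLaw (K₀ := L * M₀) hc hm hU₀ hU₁ hU₂ h₁ h₂ hZ hD0 hsep
  have e : 8 * (L : ℝ) ^ 2 / (m2 * ((L * M₀ : ℕ) : ℝ) ^ 4) = 8 / (m2 * (L : ℝ) ^ 2 * (M₀ : ℝ) ^ 4) := by
    push_cast; field_simp
  rw [e] at h
  exact h

end DecouplingKing

/-! ## §4 PART Ϣ by name -/

/-- ★★★★ **PART Ϣ PACKAGE — THE η-UNIFORM POWER-LAW DECAY OF KING's `A = 0` COVARIANCE IN FOUR DIMENSIONS**: on the fine torus `(ℤ∕LM₀)⁴` at King's scaling `c = L²`, for every `L, M₀ ≥ 1`,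
`m² > 0`, every `x, y` and every coordinate `ν`: (i) `L²|G(x,y)| ≤ (34016 + 10∕m²)∕(1+|v((x−y)_ν)|²)`; (ii) the same for every entry block of the covariant fine covariance `(−L²Δ_U+m²)⁻¹` at
every unitary `U` (real fibre). [cite: King1986, (2.13) p.653, (4.4) p.670, (4.35) p.674; Balaban1985BackgroundPropagators, Thm 3.4 p.400] -/
theorem king_powerLaw_package (L M₀ : ℕ) [NeZero L] [NeZero M₀] {m2 : ℝ} (hm : 0 < m2) {n : Type*} [Fintype n] [DecidableEq n]
    {U : Tor (fine L (cM M₀)) × Fin 4 → Matrix n n ℝ} (hU : ∀ b, U b ∈ Matrix.unitaryGroup n ℝ) (x y : Tor (fine L (cM M₀))) (i j : n) (ν : Fin 4) :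
    (L : ℝ) ^ 2 * |(lapF (fine L (cM M₀)) ((L : ℝ) ^ 2) m2)⁻¹ x y| ≤ (34016 + 10 / m2) / (1 + ((((x - y) ν).valMinAbs.natAbs : ℕ) : ℝ) ^ 2)
    ∧ (L : ℝ) ^ 2 * ‖(covLapF (fine L (cM M₀)) ((L : ℝ) ^ 2) m2 U)⁻¹ (x, i) (y, j)‖ ≤ (34016 + 10 / m2) / (1 + ((((x - y) ν).valMinAbs.natAbs : ℕ) : ℝ) ^ 2) :=
  ⟨king_green_powerLaw_eta_uniform L M₀ hm x y ν, norm_covLapF_inv_entry_le_powerLaw_eta_uniform L M₀ hm hU x y i j ν⟩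

end Summit.QuantumFields.YangMills.BalabanUVNodes.N15KingModelRung.HeatKernel

end
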